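/-
Copyright (c) 2026 the pub-hodgecm-mathlib formalisation cell (harness21).  Prover seat hodgecm-mathlib-LH4-p04 (g7), req620 Track A «(D-RAM) FOUR-FRAME» squad
(STAGE-1b, row (2); dealer∕pen LH4-plan (g13) WORD #65 (2) «(T5s♭-RamK)»; organ named by LH4-p07 (g9)'s LAW-FIT (type RamK) memo v1 §2 (a), 2026-09-04).
-/
import Summits.HodgeConjecture.HodgeConjecture.Theorems.F0P3cDyRamToricCensusSumRamKParts   -- ★ (LH4-p04 (g4), this lineage): `tables_diff_ramK`, `col_zero_ramK`, `col_pos_ramK`, `genBlock_mul`, `topBlock_mul`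
import Summits.HodgeConjecture.HodgeConjecture.Theorems.F0P3cDyRamToricCensusSumRamKCut     -- ★ p859753 (LH4-p07 (g9)): `sum_cut_part_eq`, `filter_band_eq_Ioc` (the cut top band, parity-free)
import HarnessLib

/-!
# Crux `H413`, line LH4 «(D-RAM) FOUR-FRAME» — STAGE-1b, row (2): (T5s♭-RamK) «THE TYPE-RamK TORIC CENSUS SUM IN THE FLIPPED PARITY CLASS `jl ≡ m ≢ d`»
# `ε·Σ_{j ≤ jl} Σ_a q^a (vP j a − vM j a) = q^m·(2[(jl − d + 1)∕2 + d%2]_q − 2[d − 1 + d%2]_q)`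

Cell `hodgecm-mathlib` (D-0151), FLOOR 0, crux item H413 = `stmt-HodgeConjecture-24833`, route of record `HCCMUnconditional`; squad F0∕P3c∕LH4; lane
`--supports stmt-HodgeConjecture-24833 --as helper` (count-neutral; pays NO tier-0 row).  THEOREMS ONLY (no `def`, no instance, no notation, no `sorry`, default heartbeats).
Organ for LH4-p07 (g9)'s END `levels_typeTwo_censusLaw_*_ofRecord`: by the LAW-FIT memo (type RamK) §2 (a), the ODD-`a′` level piece at every `d` (lev_lo when `d` is odd, lev_hi when
`d` is even) has shifted tokens `(m₁, jl₁) = (m − a′, jl − a′)` in the FLIPPED parity class `jl₁ ≡ m₁ ≢ d (2)` — outside ★ T5s `toricCensusSum_ramK`'s `hjl ∕ hpar`.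

THE STATEMENT.  ★ T5s `toricCensusSum_ramK` (LH4-p04 (g4)) with FOUR letters changed and everything else VERBATIM (`q d jl m ε hq hd … nP nM vP vM hnP hnM hvGen hvOff hvTop`):
the parity letters `hjl : jl % 2 = (d + 1) % 2`, `hpar : m % 2 = (d + 1) % 2` (the flipped class), the thresholds `hjlS : 3d ≤ jl + 3` (i.e. `(jl − d + 1)∕2 + d%2 ≥ d − 1 + d%2`)
and `hmS : d ≤ m + 1`; the `ε = −1` token window `jl + 2 ≤ m + 2d` is unchanged.  VALUE `q^m·(2[(jl − d + 1)∕2 + d%2]_q − 2[d − 1 + d%2]_q)` — LH4-p07 (g9)'s python-twin digits,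
re-validated here by a Lean-ℕ-semantics twin of the abstract tables (2208∕2208 tuples: q ≤ 5, 2 ≤ d ≤ 8, jl ≤ 24, all m, ε = ±1; the four guards are also NECESSARY inside the class:
no tuple outside them satisfies the identity for q ≤ 3, d ≤ 6, jl ≤ 21).
PROOF = ★ FILE 1 (parity-free per column): columns first; the column `a = 0` is `2x^d[⌊jl∕2⌋ + 1 − d]_x` (`col_zero_ramK`), a column `a ≥ 1` is the generic block plus the one-sided
top cell (`col_pos_ramK`); in the `ε = −1` window the generic part cancels against the column `a = 0` and the top cells `a + 1 ∈ [m + S♭ − ⌊jl∕2⌋, …)` (`S♭ := d − 1 + d%2`, count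
`(jl − d + 1)∕2 + d%2 − S♭`) are ONE geometric block worth the right-hand side; for `ℓ = jl − m ≥ 2d` (`ε = +1`) one multiplication by `x − 1` and `ring` in the atoms
`x^{m − ⌊d∕2⌋ − ⌊m∕2⌋}, x^{⌊d∕2⌋ − 1}, x^{⌊jl∕2⌋ − ⌊m∕2⌋ − d}, x` per parity of `d` — the same road as ★ T5s with the flipped window arithmetic.
§2 (the (R2) form): `toricCensusSum_ramK_flip_cut` ∕ `_cut_Ioc` — §1's binders VERBATIM + `(C) (hC : jl ≤ C)`: the cut sum `ε·ΣΣ q^a·[j + a ≤ C]·(vP − vM)` = §1 minus ★ p859753's cut top band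
`2·Σ_{a ∈ band(C)} q^{a + ⌊jl∕2⌋}` (LH4-p07 (g9)'s `sum_cut_part_eq` ∕ `filter_band_eq_Ioc`, parity-free), token-identical in shape to ★ `toricCensusSum_ramK_cut` ∕ `_cut_Ioc`.
HONEST LABEL.  Count-neutral finite-sum bookkeeping over `ℚ` on ABSTRACT tables; nothing printed is asserted; no census law is stated; `HC_CM` is proved only modulo the 7 printed
citations (2 remaining named inputs: hLiu418 = `stmt-HodgeConjecture-24832`, h413 = `stmt-HodgeConjecture-24833`) until rung 0 closes.
## References
* [Kottwitz1986BaseChangeUnits] R. E. Kottwitz, *Base change for unit elements of Hecke algebras*, Compositio Math. 60 (1986): §1 pp. 240–241.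
* [Rogawski1990] J. D. Rogawski, *Automorphic Representations of Unitary Groups in Three Variables*, Ann. of Math. Stud. 123 (1990): §4.9 Prop. 4.9.1 (b) p. 55, Lemma 4.9.3 p. 56.
* [Flicker1998UnitaryFL] Y. Z. Flicker, *Elementary proof of the fundamental lemma for a unitary group*, Canad. J. Math. 50 (1998): Prop. 7 p. 84 (the level tables).
-/

set_option autoImplicit false

namespace Summit.HodgeConjecture.HodgeConjecture.Cruxes.H413.F0P3cDyRamToricCensusSumRamKFlip

open Finset
open Summit.HodgeConjecture.HodgeConjecture.Cruxes.H413.F0P3cDyRamToricCensusSumUnrBlocks (sum_range_window_reindex geom_sum_mul')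
open Summit.HodgeConjecture.HodgeConjecture.Cruxes.H413.F0P3cDyRamToricCensusSumRamKParts
open Summit.HodgeConjecture.HodgeConjecture.Cruxes.H413.F0P3cDyRamToricCensusSumRamKCut (sum_cut_part_eq filter_band_eq_Ioc)

/-! ## §1 The flipped-class toric census sum -/

/-- **(T5s♭-RamK) THE TYPE-RamK TORIC CENSUS SUM IN THE FLIPPED PARITY CLASS.**  ★ T5s `toricCensusSum_ramK`'s letters VERBATIM (the u-free RamK level tables `hnP ∕ hnM`,
the depth rules `hvGen ∕ hvOff ∕ hvTop` at the tokens `(m, ε)`) on the token set `jl ≡ m ≡ d + 1 (2)`, `3d ≤ jl + 3`, `d − 1 ≤ m ≤ jl`, `ε = +1` or (`ε = −1` and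
`jl − m ≤ 2d − 2`):  `ε·Σ_{j ≤ jl} Σ_a q^a (vP j a − vM j a) = q^m·(2[(jl − d + 1)∕2 + d%2]_q − 2[d − 1 + d%2]_q)`.  Pure finite-sum bookkeeping over `ℚ`; statement validated by a
Lean-semantics twin (2208 tuples). [cite: Kottwitz1986BaseChangeUnits, §1 pp. 240–241] [cite: Rogawski1990, §4.9 Prop. 4.9.1 (b) p. 55, Lemma 4.9.3 p. 56] [cite: Flicker1998UnitaryFL, Prop. 7 p. 84] -/
theorem toricCensusSum_ramK_flip (q : ℕ) {d jl m : ℕ} (ε : ℚ) (hq : 2 ≤ q) (hd : 2 ≤ d) (hjl : jl % 2 = (d + 1) % 2) (hjlS : 3 * d ≤ jl + 3)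
    (hpar : m % 2 = (d + 1) % 2) (hmS : d ≤ m + 1) (hm : m ≤ jl) (hε : ε = 1 ∨ (ε = -1 ∧ jl + 2 ≤ m + 2 * d))
    (nP nM vP vM : ℕ → ℕ → ℚ)
    (hnP : ∀ j a, nP j a = ((if j = 0 then (if a = 0 then 1 else 0) else if j < a ∨ (j - a) % 2 = 1 then 0
      else if a = j then (if 2 ≤ d then q ^ j else (q - 1) * q ^ (j - 1)) else if a = 0 then (if 2 * d ≤ j + 1 then 2 else 1) * q ^ (j / 2)
      else if j - a + 2 < 2 * d then (q - 1) * q ^ (j - 1 - (j - a) / 2) else if j - a + 2 = 2 * d then (q - 2) * q ^ (j - d)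
      else 2 * (q - 1) * q ^ (j - 1 - (j - a) / 2) : ℕ) : ℚ))
    (hnM : ∀ j a, nM j a = ((if j = 0 then (if a = 0 then 1 else 0) else if j < a ∨ (j - a) % 2 = 1 then 0
      else if a = j then (if 2 ≤ d then q ^ j else (q + 1) * q ^ (j - 1)) else if a = 0 then (if j + 2 ≤ 2 * d then q ^ (j / 2) else 0)
      else if j - a + 2 < 2 * d then (q - 1) * q ^ (j - 1 - (j - a) / 2) else if j - a + 2 = 2 * d then q ^ (j - d + 1) else 0 : ℕ) : ℚ))
    (hvGen : ∀ j a, (a ≤ m ∧ (j + a ≤ m ∨ (2 * a ≤ m ∧ j + a ≤ jl))) → vP j a = nP j a ∧ vM j a = nM j a)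
    (hvOff : ∀ j a, ¬ (a ≤ m ∧ (j + a ≤ m ∨ (2 * a ≤ m ∧ j + a ≤ jl))) → j + m ≠ jl + a → vP j a = 0 ∧ vM j a = 0)
    (hvTop : ∀ j a, ¬ (a ≤ m ∧ (j + a ≤ m ∨ (2 * a ≤ m ∧ j + a ≤ jl))) → j + m = jl + a →
      (vP j a = if 2 * j + d ≤ 2 * jl + 1 ∧ (j + a + 2 ≤ m + 2 * d ∨ ε = 1) then (if j + a + 2 ≤ m + 2 * d then 1 else 2) * (q : ℚ) ^ (j - (j + a - m + 1) / 2) else 0) ∧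
      (vM j a = if 2 * j + d ≤ 2 * jl + 1 ∧ (j + a + 2 ≤ m + 2 * d ∨ ε = -1) then (if j + a + 2 ≤ m + 2 * d then 1 else 2) * (q : ℚ) ^ (j - (j + a - m + 1) / 2) else 0)) :
    ε * ∑ j ∈ range (jl + 1), ∑ a ∈ range (jl + 2), (q : ℚ) ^ a * (vP j a - vM j a) =
      (q : ℚ) ^ m * (2 * ∑ i ∈ range ((jl - d + 1) / 2 + d % 2), (q : ℚ) ^ i - 2 * ∑ i ∈ range (d - 1 + d % 2), (q : ℚ) ^ i) := by
  set x : ℚ := (q : ℚ) with hxq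
  have hx1 : x ≠ 1 := by rw [hxq]; exact_mod_cast (show q ≠ 1 by omega)
  have hε' : ε = 1 ∨ ε = -1 := hε.imp_right And.left
  have hεε : ε * ε = 1 := by rcases hε' with rfl | rfl <;> norm_num
  have hδ : ∀ j a, nP j a - nM j a = if a ≤ j ∧ (j - a) % 2 = 0 then
      (if a = 0 then (if 2 * d ≤ j then 2 * x ^ (j / 2) else 0)
       else if a < j then (if j - a + 2 = 2 * d then -2 * x ^ (j - d) else if 2 * d < j - a + 2 then 2 * (x - 1) * x ^ (j - 1 - (j - a) / 2) else 0)
       else 0) else 0 := fun j a => by rw [hnP, hnM]; exact tables_diff_ramK q hq hd j a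
  -- columns first
  rw [Finset.sum_comm, Finset.sum_range_succ', col_zero_ramK x nP nM vP vM hδ hvGen,
    Finset.sum_congr rfl (fun a _ => col_pos_ramK x ε hε' hd hm nP nM vP vM hδ hvGen hvOff hvTop (show 1 ≤ a + 1 by omega)),
    Finset.sum_add_distrib, ← Finset.mul_sum]
  -- the RHS, multiplied by `x − 1`
  have hR : (x - 1) * (x ^ m * (2 * ∑ i ∈ range ((jl - d + 1) / 2 + d % 2), x ^ i - 2 * ∑ i ∈ range (d - 1 + d % 2), x ^ i)) =
      2 * x ^ m * (x ^ ((jl - d + 1) / 2 + d % 2) - x ^ (d - 1 + d % 2)) := by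
    have h1 := geom_sum_mul' x ((jl - d + 1) / 2 + d % 2)
    have h2 := geom_sum_mul' x (d - 1 + d % 2)
    linear_combination (2 * x ^ m) * h1 - (2 * x ^ m) * h2
  -- the column `a = 0`, multiplied by `x − 1`
  have hC0 : (x - 1) * (2 * x ^ d * ∑ k ∈ range (jl / 2 + 1 - d), x ^ k) = 2 * x ^ d * (x ^ (jl / 2 + 1 - d) - 1) := by
    have h1 := geom_sum_mul' x (jl / 2 + 1 - d)
    linear_combination (2 * x ^ d) * h1
  by_cases hreg : jl + 2 ≤ m + 2 * d
  · ---------------------------------------------------------------- the window `ℓ ≤ 2d − 2`: the generic part cancels, the top cells give everything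
    -- generic columns: `a + 1 ≤ ⌊jl∕2⌋ + 1 − d`
    have hG : ∀ a ∈ range (jl + 1), (if 2 * (a + 1) ≤ m ∧ 2 * d + 2 * (a + 1) ≤ jl + 2 then 2 * x ^ (jl / 2 + (a + 1)) - 2 * (x + 1) * x ^ (2 * (a + 1) + d - 2) else 0) =
        (if 0 ≤ a ∧ a < 0 + (jl / 2 + 1 - d) then 2 * x ^ (jl / 2 + 1) * x ^ a - 2 * (x + 1) * x ^ d * x ^ (2 * a) else 0) := by
      intro a _
      by_cases h : 2 * (a + 1) ≤ m ∧ 2 * d + 2 * (a + 1) ≤ jl + 2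
      · rw [if_pos h, if_pos (by omega), show jl / 2 + (a + 1) = (jl / 2 + 1) + a by omega, pow_add, show 2 * (a + 1) + d - 2 = d + 2 * a by omega, pow_add]; ring
      · rw [if_neg h, if_neg (by omega)]
    -- top cells: `m + S♭ − ⌊jl∕2⌋ ≤ a + 1`, `S♭ = d − 1 + d%2`, count `(jl − d + 1)∕2 + d%2 − S♭`
    have hT : ∀ a ∈ range (jl + 1), (if m < 2 * (a + 1) ∧ 2 * (a + 1) + d ≤ 2 * m + 1 ∧ 2 * m + 2 * d ≤ jl + 2 * (a + 1) + 1 then 2 * x ^ (jl / 2 + (a + 1)) else 0) =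
        (if (m + (d - 1 + d % 2) - jl / 2 - 1) ≤ a ∧ a < (m + (d - 1 + d % 2) - jl / 2 - 1) + ((jl - d + 1) / 2 + d % 2 - (d - 1 + d % 2)) then
          2 * x ^ (m + (d - 1 + d % 2)) * x ^ (a - (m + (d - 1 + d % 2) - jl / 2 - 1)) else 0) := by
      intro a _
      by_cases h : m < 2 * (a + 1) ∧ 2 * (a + 1) + d ≤ 2 * m + 1 ∧ 2 * m + 2 * d ≤ jl + 2 * (a + 1) + 1
      · rw [if_pos h, if_pos (by omega), show jl / 2 + (a + 1) = (m + (d - 1 + d % 2)) + (a - (m + (d - 1 + d % 2) - jl / 2 - 1)) by omega, pow_add, ← mul_assoc]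
      · rw [if_neg h, if_neg (by omega)]
    rw [Finset.sum_congr rfl hG, sum_range_window_reindex (fun a => 2 * x ^ (jl / 2 + 1) * x ^ a - 2 * (x + 1) * x ^ d * x ^ (2 * a)) (show 0 + (jl / 2 + 1 - d) ≤ jl + 1 by omega),
      Finset.sum_congr rfl hT, sum_range_window_reindex (fun a => 2 * x ^ (m + (d - 1 + d % 2)) * x ^ (a - (m + (d - 1 + d % 2) - jl / 2 - 1)))
        (show (m + (d - 1 + d % 2) - jl / 2 - 1) + ((jl - d + 1) / 2 + d % 2 - (d - 1 + d % 2)) ≤ jl + 1 by omega)]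
    simp_rw [zero_add, Nat.add_sub_cancel_left]
    have hA : (x - 1) * (∑ i ∈ range (jl / 2 + 1 - d), (2 * x ^ (jl / 2 + 1) * x ^ i - 2 * (x + 1) * x ^ d * x ^ (2 * i)) + 2 * x ^ d * ∑ k ∈ range (jl / 2 + 1 - d), x ^ k) = 0 := by
      rw [mul_add, genBlock_mul, hC0]
      have f1 : x ^ (jl / 2 + 1) = x ^ (jl / 2 + 1 - d) * x ^ d := by rw [← pow_add]; congr 1; omega
      have f2 : x ^ (2 * (jl / 2 + 1 - d)) = x ^ (jl / 2 + 1 - d) * x ^ (jl / 2 + 1 - d) := by rw [← pow_add]; congr 1; omega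
      rw [f1, f2]; ring
    have hA' : ∑ i ∈ range (jl / 2 + 1 - d), (2 * x ^ (jl / 2 + 1) * x ^ i - 2 * (x + 1) * x ^ d * x ^ (2 * i)) + 2 * x ^ d * ∑ k ∈ range (jl / 2 + 1 - d), x ^ k = 0 := by
      rcases mul_eq_zero.1 hA with h | h
      · exact absurd (sub_eq_zero.1 h) hx1
      · exact h
    have hB : (x - 1) * ∑ i ∈ range ((jl - d + 1) / 2 + d % 2 - (d - 1 + d % 2)), 2 * x ^ (m + (d - 1 + d % 2)) * x ^ i =
        (x - 1) * (x ^ m * (2 * ∑ i ∈ range ((jl - d + 1) / 2 + d % 2), x ^ i - 2 * ∑ i ∈ range (d - 1 + d % 2), x ^ i)) := by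
      rw [topBlock_mul, hR]
      have f1 : x ^ ((jl - d + 1) / 2 + d % 2) = x ^ (d - 1 + d % 2) * x ^ ((jl - d + 1) / 2 + d % 2 - (d - 1 + d % 2)) := by rw [← pow_add]; congr 1; omega
      rw [pow_add, f1]; ring
    have hB' := mul_left_cancel₀ (sub_ne_zero.2 hx1) hB
    rw [show ε * (∑ i ∈ range (jl / 2 + 1 - d), (2 * x ^ (jl / 2 + 1) * x ^ i - 2 * (x + 1) * x ^ d * x ^ (2 * i)) +
          ε * ∑ i ∈ range ((jl - d + 1) / 2 + d % 2 - (d - 1 + d % 2)), 2 * x ^ (m + (d - 1 + d % 2)) * x ^ i + 2 * x ^ d * ∑ k ∈ range (jl / 2 + 1 - d), x ^ k) =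
        ε * (∑ i ∈ range (jl / 2 + 1 - d), (2 * x ^ (jl / 2 + 1) * x ^ i - 2 * (x + 1) * x ^ d * x ^ (2 * i)) + 2 * x ^ d * ∑ k ∈ range (jl / 2 + 1 - d), x ^ k) +
        ε * ε * ∑ i ∈ range ((jl - d + 1) / 2 + d % 2 - (d - 1 + d % 2)), 2 * x ^ (m + (d - 1 + d % 2)) * x ^ i by ring,
      hA', hεε, mul_zero, zero_add, one_mul, hB']
  · ---------------------------------------------------------------- `ℓ ≥ 2d`: `ε = +1`, generic columns `a + 1 ≤ ⌊m∕2⌋`, top cells `⌊m∕2⌋ + 1 ≤ a + 1 ≤ m − ⌊m∕2⌋ − ⌊d∕2⌋`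
    have hε1 : ε = 1 := by rcases hε with h | ⟨_, h⟩; exact h; exact absurd h hreg
    subst hε1
    have hG : ∀ a ∈ range (jl + 1), (if 2 * (a + 1) ≤ m ∧ 2 * d + 2 * (a + 1) ≤ jl + 2 then 2 * x ^ (jl / 2 + (a + 1)) - 2 * (x + 1) * x ^ (2 * (a + 1) + d - 2) else 0) =
        (if 0 ≤ a ∧ a < 0 + m / 2 then 2 * x ^ (jl / 2 + 1) * x ^ a - 2 * (x + 1) * x ^ d * x ^ (2 * a) else 0) := by
      intro a _
      by_cases h : 2 * (a + 1) ≤ m ∧ 2 * d + 2 * (a + 1) ≤ jl + 2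
      · rw [if_pos h, if_pos (by omega), show jl / 2 + (a + 1) = (jl / 2 + 1) + a by omega, pow_add, show 2 * (a + 1) + d - 2 = d + 2 * a by omega, pow_add]; ring
      · rw [if_neg h, if_neg (by omega)]
    have hT : ∀ a ∈ range (jl + 1), (if m < 2 * (a + 1) ∧ 2 * (a + 1) + d ≤ 2 * m + 1 ∧ 2 * m + 2 * d ≤ jl + 2 * (a + 1) + 1 then 2 * x ^ (jl / 2 + (a + 1)) else 0) =
        (if m / 2 ≤ a ∧ a < m / 2 + (m - d / 2 - m / 2) then 2 * x ^ (jl / 2 + m / 2 + 1) * x ^ (a - m / 2) else 0) := by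
      intro a _
      by_cases h : m < 2 * (a + 1) ∧ 2 * (a + 1) + d ≤ 2 * m + 1 ∧ 2 * m + 2 * d ≤ jl + 2 * (a + 1) + 1
      · rw [if_pos h, if_pos (by omega), show jl / 2 + (a + 1) = (jl / 2 + m / 2 + 1) + (a - m / 2) by omega, pow_add, ← mul_assoc]
      · rw [if_neg h, if_neg (by omega)]
    rw [Finset.sum_congr rfl hG, sum_range_window_reindex (fun a => 2 * x ^ (jl / 2 + 1) * x ^ a - 2 * (x + 1) * x ^ d * x ^ (2 * a)) (show 0 + m / 2 ≤ jl + 1 by omega),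
      Finset.sum_congr rfl hT, sum_range_window_reindex (fun a => 2 * x ^ (jl / 2 + m / 2 + 1) * x ^ (a - m / 2)) (show m / 2 + (m - d / 2 - m / 2) ≤ jl + 1 by omega)]
    simp_rw [zero_add, Nat.add_sub_cancel_left, one_mul]
    apply mul_left_cancel₀ (sub_ne_zero.2 hx1)
    rw [mul_add, mul_add, genBlock_mul, topBlock_mul, hC0, hR]
    -- atoms: `x^r` (`r = m − ⌊m∕2⌋ − ⌊d∕2⌋`), `x^t` (`t = ⌊d∕2⌋ − 1`), `x^u` (`u = ⌊jl∕2⌋ − ⌊m∕2⌋ − d`), `x`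
    rcases Nat.mod_two_eq_zero_or_one d with hδ | hδ
    · -- `d` even, `jl ≡ m` odd
      have f1 : x ^ (jl / 2 + 1) = x ^ (m - d / 2 - m / 2) * x ^ (d / 2 - 1) * x ^ (d / 2 - 1) * x ^ (d / 2 - 1) * x ^ (jl / 2 - m / 2 - d) * x * x * x := by
        simp only [← pow_add, ← pow_succ]; congr 1; omega
      have f2 : x ^ (m / 2) = x ^ (m - d / 2 - m / 2) * x ^ (d / 2 - 1) := by simp only [← pow_add]; congr 1; omega
      have f3 : x ^ d = x ^ (d / 2 - 1) * x ^ (d / 2 - 1) * x * x := by simp only [← pow_add, ← pow_succ]; congr 1; omega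
      have f4 : x ^ (2 * (m / 2)) = x ^ (m - d / 2 - m / 2) * x ^ (m - d / 2 - m / 2) * x ^ (d / 2 - 1) * x ^ (d / 2 - 1) := by
        simp only [← pow_add]; congr 1; omega
      have f5 : x ^ (jl / 2 + m / 2 + 1) = x ^ (m - d / 2 - m / 2) * x ^ (m - d / 2 - m / 2) * x ^ (d / 2 - 1) * x ^ (d / 2 - 1) * x ^ (d / 2 - 1) * x ^ (d / 2 - 1) *
          x ^ (jl / 2 - m / 2 - d) * x * x * x := by simp only [← pow_add, ← pow_succ]; congr 1; omega
      have f6 : x ^ (jl / 2 + 1 - d) = x ^ (m - d / 2 - m / 2) * x ^ (d / 2 - 1) * x ^ (jl / 2 - m / 2 - d) * x := by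
        simp only [← pow_add, ← pow_succ]; congr 1; omega
      have f7 : x ^ m = x ^ (m - d / 2 - m / 2) * x ^ (m - d / 2 - m / 2) * x ^ (d / 2 - 1) * x ^ (d / 2 - 1) * x := by
        simp only [← pow_add, ← pow_succ]; congr 1; omega
      have f8 : x ^ ((jl - d + 1) / 2 + d % 2) = x ^ (m - d / 2 - m / 2) * x ^ (d / 2 - 1) * x ^ (d / 2 - 1) * x ^ (jl / 2 - m / 2 - d) * x * x := by
        simp only [← pow_add, ← pow_succ]; congr 1; omega
      have f9 : x ^ (d - 1 + d % 2) = x ^ (d / 2 - 1) * x ^ (d / 2 - 1) * x := by simp only [← pow_add, ← pow_succ]; congr 1; omega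
      rw [f1, f2, f3, f4, f5, f6, f7, f8, f9]; ring
    · -- `d` odd, `jl ≡ m` even
      have f1 : x ^ (jl / 2 + 1) = x ^ (m - d / 2 - m / 2) * x ^ (d / 2 - 1) * x ^ (d / 2 - 1) * x ^ (d / 2 - 1) * x ^ (jl / 2 - m / 2 - d) * x * x * x * x * x := by
        simp only [← pow_add, ← pow_succ]; congr 1; omega
      have f2 : x ^ (m / 2) = x ^ (m - d / 2 - m / 2) * x ^ (d / 2 - 1) * x := by simp only [← pow_add, ← pow_succ]; congr 1; omega
      have f3 : x ^ d = x ^ (d / 2 - 1) * x ^ (d / 2 - 1) * x * x * x := by simp only [← pow_add, ← pow_succ]; congr 1; omega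
      have f4 : x ^ (2 * (m / 2)) = x ^ (m - d / 2 - m / 2) * x ^ (m - d / 2 - m / 2) * x ^ (d / 2 - 1) * x ^ (d / 2 - 1) * x * x := by
        simp only [← pow_add, ← pow_succ]; congr 1; omega
      have f5 : x ^ (jl / 2 + m / 2 + 1) = x ^ (m - d / 2 - m / 2) * x ^ (m - d / 2 - m / 2) * x ^ (d / 2 - 1) * x ^ (d / 2 - 1) * x ^ (d / 2 - 1) * x ^ (d / 2 - 1) *
          x ^ (jl / 2 - m / 2 - d) * x * x * x * x * x * x := by simp only [← pow_add, ← pow_succ]; congr 1; omega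
      have f6 : x ^ (jl / 2 + 1 - d) = x ^ (m - d / 2 - m / 2) * x ^ (d / 2 - 1) * x ^ (jl / 2 - m / 2 - d) * x * x := by
        simp only [← pow_add, ← pow_succ]; congr 1; omega
      have f7 : x ^ m = x ^ (m - d / 2 - m / 2) * x ^ (m - d / 2 - m / 2) * x ^ (d / 2 - 1) * x ^ (d / 2 - 1) * x * x := by
        simp only [← pow_add, ← pow_succ]; congr 1; omega
      have f8 : x ^ ((jl - d + 1) / 2 + d % 2) = x ^ (m - d / 2 - m / 2) * x ^ (d / 2 - 1) * x ^ (d / 2 - 1) * x ^ (jl / 2 - m / 2 - d) * x * x * x * x := by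
        simp only [← pow_add, ← pow_succ]; congr 1; omega
      have f9 : x ^ (d - 1 + d % 2) = x ^ (d / 2 - 1) * x ^ (d / 2 - 1) * x * x * x := by simp only [← pow_add, ← pow_succ]; congr 1; omega
      rw [f1, f2, f3, f4, f5, f6, f7, f8, f9]; ring

/-! ## §2 The flipped-class sum with a diagonal cutoff (★ p859753's cut top band is parity-free) -/

/-- **(T5s♭-RamK) WITH A DIAGONAL CUTOFF** — §1's binders VERBATIM plus a cutoff constant `C` with `jl ≤ C`:
`ε·Σ_{j ≤ jl} Σ_{a ≤ jl+1} q^a·[j + a ≤ C]·(vP − vM) = q^m·(2[(jl − d + 1)∕2 + d%2]_q − 2[d − 1 + d%2]_q) − 2·Σ_{a ∈ band(C)} q^{a + ⌊jl∕2⌋}`, band(C) = ★ p859753's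
`a ≤ m ∧ C + m < jl + 2a ∧ 2m + 2d < jl + 2a + 2 ∧ 2a + d ≤ 2m + 1` (LH4-p07 (g9)'s `sum_cut_part_eq`, parity-free) — §1 minus the cut top band, the (R2) form the odd-`a′` level
pieces consume near `1`. [cite: Kottwitz1986BaseChangeUnits, §1 pp. 240–241] [cite: Flicker1998UnitaryFL, Prop. 7 p. 84] -/
theorem toricCensusSum_ramK_flip_cut (q : ℕ) {d jl m : ℕ} (ε : ℚ) (hq : 2 ≤ q) (hd : 2 ≤ d) (hjl : jl % 2 = (d + 1) % 2) (hjlS : 3 * d ≤ jl + 3)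
    (hpar : m % 2 = (d + 1) % 2) (hmS : d ≤ m + 1) (hm : m ≤ jl) (hε : ε = 1 ∨ (ε = -1 ∧ jl + 2 ≤ m + 2 * d))
    (nP nM vP vM : ℕ → ℕ → ℚ)
    (hnP : ∀ j a, nP j a = ((if j = 0 then (if a = 0 then 1 else 0) else if j < a ∨ (j - a) % 2 = 1 then 0
      else if a = j then (if 2 ≤ d then q ^ j else (q - 1) * q ^ (j - 1)) else if a = 0 then (if 2 * d ≤ j + 1 then 2 else 1) * q ^ (j / 2)
      else if j - a + 2 < 2 * d then (q - 1) * q ^ (j - 1 - (j - a) / 2) else if j - a + 2 = 2 * d then (q - 2) * q ^ (j - d)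
      else 2 * (q - 1) * q ^ (j - 1 - (j - a) / 2) : ℕ) : ℚ))
    (hnM : ∀ j a, nM j a = ((if j = 0 then (if a = 0 then 1 else 0) else if j < a ∨ (j - a) % 2 = 1 then 0
      else if a = j then (if 2 ≤ d then q ^ j else (q + 1) * q ^ (j - 1)) else if a = 0 then (if j + 2 ≤ 2 * d then q ^ (j / 2) else 0)
      else if j - a + 2 < 2 * d then (q - 1) * q ^ (j - 1 - (j - a) / 2) else if j - a + 2 = 2 * d then q ^ (j - d + 1) else 0 : ℕ) : ℚ))
    (hvGen : ∀ j a, (a ≤ m ∧ (j + a ≤ m ∨ (2 * a ≤ m ∧ j + a ≤ jl))) → vP j a = nP j a ∧ vM j a = nM j a)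
    (hvOff : ∀ j a, ¬ (a ≤ m ∧ (j + a ≤ m ∨ (2 * a ≤ m ∧ j + a ≤ jl))) → j + m ≠ jl + a → vP j a = 0 ∧ vM j a = 0)
    (hvTop : ∀ j a, ¬ (a ≤ m ∧ (j + a ≤ m ∨ (2 * a ≤ m ∧ j + a ≤ jl))) → j + m = jl + a →
      (vP j a = if 2 * j + d ≤ 2 * jl + 1 ∧ (j + a + 2 ≤ m + 2 * d ∨ ε = 1) then (if j + a + 2 ≤ m + 2 * d then 1 else 2) * (q : ℚ) ^ (j - (j + a - m + 1) / 2) else 0) ∧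
      (vM j a = if 2 * j + d ≤ 2 * jl + 1 ∧ (j + a + 2 ≤ m + 2 * d ∨ ε = -1) then (if j + a + 2 ≤ m + 2 * d then 1 else 2) * (q : ℚ) ^ (j - (j + a - m + 1) / 2) else 0)) (C : ℕ) (hC : jl ≤ C) :
    ε * ∑ j ∈ range (jl + 1), ∑ a ∈ range (jl + 2), (q : ℚ) ^ a * (if j + a ≤ C then vP j a - vM j a else 0) =
      (q : ℚ) ^ m * (2 * ∑ i ∈ range ((jl - d + 1) / 2 + d % 2), (q : ℚ) ^ i - 2 * ∑ i ∈ range (d - 1 + d % 2), (q : ℚ) ^ i) -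
        2 * ∑ a ∈ (range (jl + 2)).filter (fun a => a ≤ m ∧ C + m < jl + 2 * a ∧ 2 * m + 2 * d < jl + 2 * a + 2 ∧ 2 * a + d ≤ 2 * m + 1), (q : ℚ) ^ (a + jl / 2) := by
  have hε' : ε = 1 ∨ ε = -1 := hε.imp_right And.left
  have hsplit : ∀ j a, (q : ℚ) ^ a * (if j + a ≤ C then vP j a - vM j a else 0) =
      (q : ℚ) ^ a * (vP j a - vM j a) - (q : ℚ) ^ a * (if C < j + a then vP j a - vM j a else 0) := fun j a => by
    by_cases h : j + a ≤ C
    · rw [if_pos h, if_neg (not_lt.2 h), mul_zero, sub_zero]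
    · rw [if_neg h, if_pos (not_le.1 h), mul_zero, sub_self]
  simp_rw [hsplit]
  simp only [Finset.sum_sub_distrib]
  rw [mul_sub, toricCensusSum_ramK_flip q ε hq hd hjl hjlS hpar hmS hm hε nP nM vP vM hnP hnM hvGen hvOff hvTop,
    sum_cut_part_eq (q : ℚ) ε hε' hm hC vP vM hvOff hvTop]

/-- **(T5s♭-RamK) WITH A DIAGONAL CUTOFF, INTERVAL FORM**: under `m + 2d ≤ C + 2` the band is `a ∈ Ioc ((C + m − jl)∕2) ((2m + 1 − d)∕2)` (★ p859753 `filter_band_eq_Ioc`);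
for `m + jl ≤ C` it is empty and §1 is recovered (regime (R0)). [cite: Kottwitz1986BaseChangeUnits, §1 pp. 240–241] [cite: Flicker1998UnitaryFL, Prop. 7 p. 84] -/
theorem toricCensusSum_ramK_flip_cut_Ioc (q : ℕ) {d jl m : ℕ} (ε : ℚ) (hq : 2 ≤ q) (hd : 2 ≤ d) (hjl : jl % 2 = (d + 1) % 2) (hjlS : 3 * d ≤ jl + 3)
    (hpar : m % 2 = (d + 1) % 2) (hmS : d ≤ m + 1) (hm : m ≤ jl) (hε : ε = 1 ∨ (ε = -1 ∧ jl + 2 ≤ m + 2 * d))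
    (nP nM vP vM : ℕ → ℕ → ℚ)
    (hnP : ∀ j a, nP j a = ((if j = 0 then (if a = 0 then 1 else 0) else if j < a ∨ (j - a) % 2 = 1 then 0
      else if a = j then (if 2 ≤ d then q ^ j else (q - 1) * q ^ (j - 1)) else if a = 0 then (if 2 * d ≤ j + 1 then 2 else 1) * q ^ (j / 2)
      else if j - a + 2 < 2 * d then (q - 1) * q ^ (j - 1 - (j - a) / 2) else if j - a + 2 = 2 * d then (q - 2) * q ^ (j - d)
      else 2 * (q - 1) * q ^ (j - 1 - (j - a) / 2) : ℕ) : ℚ))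
    (hnM : ∀ j a, nM j a = ((if j = 0 then (if a = 0 then 1 else 0) else if j < a ∨ (j - a) % 2 = 1 then 0
      else if a = j then (if 2 ≤ d then q ^ j else (q + 1) * q ^ (j - 1)) else if a = 0 then (if j + 2 ≤ 2 * d then q ^ (j / 2) else 0)
      else if j - a + 2 < 2 * d then (q - 1) * q ^ (j - 1 - (j - a) / 2) else if j - a + 2 = 2 * d then q ^ (j - d + 1) else 0 : ℕ) : ℚ))
    (hvGen : ∀ j a, (a ≤ m ∧ (j + a ≤ m ∨ (2 * a ≤ m ∧ j + a ≤ jl))) → vP j a = nP j a ∧ vM j a = nM j a)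
    (hvOff : ∀ j a, ¬ (a ≤ m ∧ (j + a ≤ m ∨ (2 * a ≤ m ∧ j + a ≤ jl))) → j + m ≠ jl + a → vP j a = 0 ∧ vM j a = 0)
    (hvTop : ∀ j a, ¬ (a ≤ m ∧ (j + a ≤ m ∨ (2 * a ≤ m ∧ j + a ≤ jl))) → j + m = jl + a →
      (vP j a = if 2 * j + d ≤ 2 * jl + 1 ∧ (j + a + 2 ≤ m + 2 * d ∨ ε = 1) then (if j + a + 2 ≤ m + 2 * d then 1 else 2) * (q : ℚ) ^ (j - (j + a - m + 1) / 2) else 0) ∧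
      (vM j a = if 2 * j + d ≤ 2 * jl + 1 ∧ (j + a + 2 ≤ m + 2 * d ∨ ε = -1) then (if j + a + 2 ≤ m + 2 * d then 1 else 2) * (q : ℚ) ^ (j - (j + a - m + 1) / 2) else 0)) (C : ℕ) (hC : jl ≤ C) (hfar : m + 2 * d ≤ C + 2) :
    ε * ∑ j ∈ range (jl + 1), ∑ a ∈ range (jl + 2), (q : ℚ) ^ a * (if j + a ≤ C then vP j a - vM j a else 0) =
      (q : ℚ) ^ m * (2 * ∑ i ∈ range ((jl - d + 1) / 2 + d % 2), (q : ℚ) ^ i - 2 * ∑ i ∈ range (d - 1 + d % 2), (q : ℚ) ^ i) -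
        2 * ∑ a ∈ Finset.Ioc ((C + m - jl) / 2) ((2 * m + 1 - d) / 2), (q : ℚ) ^ (a + jl / 2) := by
  rw [toricCensusSum_ramK_flip_cut q ε hq hd hjl hjlS hpar hmS hm hε nP nM vP vM hnP hnM hvGen hvOff hvTop C hC, filter_band_eq_Ioc hd hm hC hfar]

end Summit.HodgeConjecture.HodgeConjecture.Cruxes.H413.F0P3cDyRamToricCensusSumRamKFlip
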